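import Mathlib
import HarnessLib
import Summits.HubbardSuperconductivity.HubbardSuperconductivity.Theorems.KLProgrammeC4aTwoNodeControl
import Summits.HubbardSuperconductivity.HubbardSuperconductivity.Theorems.KLProgrammeC4aTransversalZeroControl
import Summits.HubbardSuperconductivity.HubbardSuperconductivity.Theorems.KLProgrammeC4aPartnerBandJetTables

/-!
# Route `KLProgramme` — crux C4a, S3 brick (B4, DIRECT SHEET): BAND-DISTANCE CONTROL of the co-moving jets of the pp partner band at TRANSVERSAL configurations
# (generic and near-Cooper), assembled — transversal two-zero control at the loop's Fermi level with the `H₀`, `H₁` ceilings BY NAME, modulo the transversality rows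

Cell `gate-hubbard-kl`, seat hubbard-kl-k3c3-p3 (g25; row «implicit-function / monotonicity route for μ(n)»).  Located brick «(B4)-DIRECT-COUNT» (memo
HOME/hubbard-kl-k3c3-p3/B4-DIRECT-COUNT.md §1 (iii)–(iv)), the companion of `…C4aBandDistanceControl` (near TANGENCY, two-node/convexity mechanism) for the configurations where
the two θ-fixed crossings `φ = 0` (loop at `k`) and `φ = ϑ` (loop at `q′`) are TRANSVERSAL zeros of the level-`0` profile `f = ē(0,·;0,ϑ)`: given the transversality rows
(slope `σ ≤ εᵢ·∂_φ ē` on `δ`-neighbourhoods of the two crossings, `εᵢ = ±1`, and a floor `κ ≤ |ē|` off them on the loop-angle set `S` — the content of `…C4aPartnerBandCrossingSlopes` /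
`…C4aLoopNondegeneracy` on the direct sheet, taken here as hypotheses), the jet profiles `h_m = ∂ᵐ_ψ|_θ ē(0,·;0,ϑ)` vanish at the same two points (`…C4aTwoNodeControl`) and carry the
uniform ceilings `|h_m| ≤ m!𝒦Dᵐ`, `|h_m′| ≤ (m+1)!𝒦D^{m+1}` (`…C4aPartnerBandJetTables`), so `…C4aTransversalZeroControl.abs_le_mul_abs_of_transversal_zeros_deriv` gives

  **`abs_iteratedDeriv_partnerBand_pp_base_le_mul_abs_transversal`**: `|∂ᵐ_ψ|_θ ē(0,φ;0,ϑ)| ≤ max((m+1)!𝒦D^{m+1}/σ, m!𝒦Dᵐ/κ)·|ē(0,φ;0,ϑ,θ)|` for `φ ∈ S`.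

Near the Cooper configuration `ϑ = π + η` the rows scale as `σ, κ ∝ |η|` while the ceilings of `ē − e`'s jets scale the same way (exact nesting at `η = 0`), so the quotient is
`η`-uniform once the `η`-scaled ceilings are supplied in place of the uniform tables (same statement, hypotheses `H₀`, `H₁`: `…_of_ceilings`).  The loop level `e` and the offset `ρ`
are then transported by the level / offset rows exactly as in `…C4aBandDistanceControl` (`…C4aTwoNodeControl.abs_le_mul_abs_add_of_displacement`).
Binder shape = `…C4aPathJetsSix`.  Pure bookkeeping on landed objects; nothing about the model's sizes; nothing asserts (C), K3 or superconductivity.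
References: FST II CPAM 51 (1998) §3; BGM 2006 §2.4 [cite: BenfattoGiulianiMastropietro2006].
-/

noncomputable section

namespace Summit.HubbardSuperconductivity.HubbardSuperconductivity.Theorems.C4a

set_option linter.dupNamespace false -- summit = problem name (single-conjunct summit), D-0017

open Real Set Filter
open scoped Topology ContDiff
open Literature.MathematicalPhysics.QuantumLattice Literature.MathematicalPhysics.QuantumLattice.BandSectorCounting Literature.Probability.LatticeModels
open Summit.HubbardSuperconductivity.HubbardSuperconductivity.Theorems.KLRegimeSplit
open Summit.HubbardSuperconductivity.HubbardSuperconductivity.Theorems.DispersionFlow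
open Summit.HubbardSuperconductivity.HubbardSuperconductivity.Theorems.PerturbedFermiCurve

section Sizes

variable {K : TrigPolyC4v} {A : ℝ} (hA : ∀ p : Momentum, ∀ j ≤ 2, ‖iteratedFDeriv ℝ j (frameShift K) p‖ ≤ A) (hA20 : A ≤ 1 / 20)
  (hd : klCurveD ≤ (bandBounds (show (-4 : ℝ) < -1.1 by norm_num) (show (-1.1 : ℝ) ≤ -0.1 by norm_num)
    (show (-0.1 : ℝ) < 0 by norm_num)).Dtmin - 2 * A)
  {μ r : ℝ} (hr : 0 < r) (hlo : (-1.1 : ℝ) < μ - r - A) (hhi : μ + r + A < -0.1)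
  {A₃ A₄ A₅ A₆ : ℝ} (hA₃ : ∀ p : Momentum, ‖iteratedFDeriv ℝ 3 (frameShift K) p‖ ≤ A₃)
  (hA₄ : ∀ p : Momentum, ‖iteratedFDeriv ℝ 4 (frameShift K) p‖ ≤ A₄)
  (hA₅ : ∀ p : Momentum, ‖iteratedFDeriv ℝ 5 (frameShift K) p‖ ≤ A₅)
  (hA₆ : ∀ p : Momentum, ‖iteratedFDeriv ℝ 6 (frameShift K) p‖ ≤ A₆)
include hA hA20 hd hr hlo hhi hA₃ hA₄ hA₅ hA₆

omit hA20 hA₃ hA₄ hA₅ hA₆ in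
/-- **TRANSVERSAL CONTROL WITH GIVEN CEILINGS** (the near-Cooper form: `H₀`, `H₁` supplied, e.g. `∝ |ϑ − π|`): at `ρ = 0`, loop level `0`, if the level-`0` profile
`f = ē(0,·;0,ϑ)` has slope `σ ≤ εᵢ·f′` on the `δ`-neighbourhoods of the θ-fixed crossings `0, ϑ` (`εᵢ = ±1`) and the floor `κ ≤ |f|` off them on `S`, and the `m`-th jet profile `h`
has `|h′| ≤ H₁` near the crossings and `|h| ≤ H₀` off them, then `|h(φ)| ≤ max(H₁/σ, H₀/κ)·|f(φ)|` for `φ ∈ S`. -/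
theorem abs_iteratedDeriv_partnerBand_pp_base_le_mul_abs_of_ceilings (ϑ θ : ℝ) (m : ℕ) {S : Set ℝ} {δ σ κ H₀ H₁ : ℝ}
    (hσ : 0 < σ) (hκ : 0 < κ) (hH₀ : 0 ≤ H₀) (hδ : 0 ≤ δ) {ε₁ ε₂ : ℝ} (hε₁ : ε₁ = 1 ∨ ε₁ = -1) (hε₂ : ε₂ = 1 ∨ ε₂ = -1)
    (hσ₁ : ∀ x ∈ Icc (0 - δ) (0 + δ), σ ≤ ε₁ * deriv (fun φ : ℝ => frameLevel μ K (levelPoint μ K 0 θ + levelPoint μ K 0 (ϑ + θ) - levelPoint μ K 0 (φ + θ))) x)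
    (hσ₂ : ∀ x ∈ Icc (ϑ - δ) (ϑ + δ), σ ≤ ε₂ * deriv (fun φ : ℝ => frameLevel μ K (levelPoint μ K 0 θ + levelPoint μ K 0 (ϑ + θ) - levelPoint μ K 0 (φ + θ))) x)
    (hfloor : ∀ t ∈ S, δ < |t - 0| → δ < |t - ϑ| → κ ≤ |frameLevel μ K (levelPoint μ K 0 θ + levelPoint μ K 0 (ϑ + θ) - levelPoint μ K 0 (t + θ))|)
    (hH₁ : ∀ i ∈ ({0, ϑ} : Set ℝ), ∀ x ∈ Icc (i - δ) (i + δ), |deriv (fun φ : ℝ =>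
      iteratedDeriv m (fun ψ : ℝ => frameLevel μ K (levelPoint μ K 0 ψ + levelPoint μ K 0 (ϑ + ψ) - levelPoint μ K 0 (φ + ψ))) θ) x| ≤ H₁)
    (hH₀' : ∀ t ∈ S, δ < |t - 0| → δ < |t - ϑ| → |iteratedDeriv m (fun ψ : ℝ =>
      frameLevel μ K (levelPoint μ K 0 ψ + levelPoint μ K 0 (ϑ + ψ) - levelPoint μ K 0 (t + ψ))) θ| ≤ H₀)
    {φ : ℝ} (hφ : φ ∈ S) :
    |iteratedDeriv m (fun ψ : ℝ => frameLevel μ K (levelPoint μ K 0 ψ + levelPoint μ K 0 (ϑ + ψ) - levelPoint μ K 0 (φ + ψ))) θ| ≤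
      max (H₁ / σ) (H₀ / κ) * |frameLevel μ K (levelPoint μ K 0 θ + levelPoint μ K 0 (ϑ + θ) - levelPoint μ K 0 (φ + θ))| := by
  set B₀ := bandBounds (show (-4 : ℝ) < -1.1 by norm_num) (show (-1.1 : ℝ) ≤ -0.1 by norm_num) (show (-0.1 : ℝ) < 0 by norm_num) with hB₀
  have hADt : 2 * A < B₀.Dtmin := by have := klCurveD_pos; linarith
  have h0 : |(0 : ℝ)| < r := by simpa using hr
  -- the two profiles are smooth, hence differentiable with derivative `deriv`
  have hfC : ContDiff ℝ 1 (fun φ : ℝ => frameLevel μ K (levelPoint μ K 0 θ + levelPoint μ K 0 (ϑ + θ) - levelPoint μ K 0 (φ + θ))) :=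
    (EngineV8.contDiff_frameLevel μ K).comp
      (contDiff_const.sub ((contDiff_levelPoint_angle B₀ hA hADt hlo hhi h0).comp (contDiff_id.add contDiff_const)))
  have hhC : ContDiff ℝ 1 (fun φ : ℝ =>
      iteratedDeriv m (fun ψ : ℝ => frameLevel μ K (levelPoint μ K 0 ψ + levelPoint μ K 0 (ϑ + ψ) - levelPoint μ K 0 (φ + ψ))) θ) :=
    contDiff_partnerBand_pp_jet_profile B₀ hA hADt hr hlo hhi h0 h0 ϑ θ m
  have hfd : ∀ x, HasDerivAt (fun φ : ℝ => frameLevel μ K (levelPoint μ K 0 θ + levelPoint μ K 0 (ϑ + θ) - levelPoint μ K 0 (φ + θ)))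
      (deriv (fun φ : ℝ => frameLevel μ K (levelPoint μ K 0 θ + levelPoint μ K 0 (ϑ + θ) - levelPoint μ K 0 (φ + θ))) x) x :=
    fun x => ((hfC.differentiable (by simp)) x).hasDerivAt
  have hhd : ∀ x, HasDerivAt (fun φ : ℝ =>
      iteratedDeriv m (fun ψ : ℝ => frameLevel μ K (levelPoint μ K 0 ψ + levelPoint μ K 0 (ϑ + ψ) - levelPoint μ K 0 (φ + ψ))) θ)
      (deriv (fun φ : ℝ => iteratedDeriv m (fun ψ : ℝ => frameLevel μ K (levelPoint μ K 0 ψ + levelPoint μ K 0 (ϑ + ψ) - levelPoint μ K 0 (φ + ψ))) θ) x) x :=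
    fun x => ((hhC.differentiable (by simp)) x).hasDerivAt
  have hfz₁ : (fun φ : ℝ => frameLevel μ K (levelPoint μ K 0 θ + levelPoint μ K 0 (ϑ + θ) - levelPoint μ K 0 (φ + θ))) 0 = 0 :=
    partnerBand_pp_level_zero_at_k B₀ hA hr hlo hhi ϑ θ
  have hfz₂ : (fun φ : ℝ => frameLevel μ K (levelPoint μ K 0 θ + levelPoint μ K 0 (ϑ + θ) - levelPoint μ K 0 (φ + θ))) ϑ = 0 :=
    partnerBand_pp_level_zero_at_q B₀ hA hr hlo hhi ϑ θ
  have hhz₁ := iteratedDeriv_partnerBand_pp_base_at_k B₀ hA hr hlo hhi ϑ θ m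
  have hhz₂ := iteratedDeriv_partnerBand_pp_base_at_q B₀ hA hr hlo hhi ϑ θ m
  exact abs_le_mul_abs_of_transversal_zeros_deriv (S := S) hσ hκ hH₀ hδ hε₁ hε₂ (fun _ _ x _ => hfd x) (fun _ _ x _ => hhd x) hσ₁ hσ₂ hH₁
    hfz₁ hfz₂ hhz₁ hhz₂ hfloor hH₀' hφ

/-- **BAND-DISTANCE CONTROL AT TRANSVERSAL CONFIGURATIONS with the uniform tables** (`H₀ = m!𝒦Dᵐ`, `H₁ = (m+1)!𝒦D^{m+1}` from `…C4aPartnerBandJetTables`): for `m ≤ 5`,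
rows `(2 + 2ⁱ)·msD6 i ≤ Dⁱ` (`i ≤ m+1`), `‖Dⁱe_K‖ ≤ 𝒦` (`i ≤ m+1`), and the transversality rows of the configuration:
`|∂ᵐ_ψ|_θ ē(0,φ;0,ϑ)| ≤ max((m+1)!𝒦D^{m+1}/σ, m!𝒦Dᵐ/κ)·|ē(0,φ;0,ϑ,θ)|` for `φ ∈ S`. -/
theorem abs_iteratedDeriv_partnerBand_pp_base_le_mul_abs_transversal {m : ℕ} (hm : m ≤ 5) {𝒦 : ℝ}
    (hK : ∀ i, i ≤ m + 1 → ∀ p : Momentum, ‖iteratedFDeriv ℝ i (frameLevel μ K) p‖ ≤ 𝒦)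
    {D : ℝ} (hDrow : ∀ i, 1 ≤ i → i ≤ m + 1 → (2 + 2 ^ i) * msD6 A₃ A₄ A₅ A₆ i ≤ D ^ i)
    (ϑ θ : ℝ) {S : Set ℝ} {δ σ κ : ℝ} (hσ : 0 < σ) (hκ : 0 < κ) (hδ : 0 ≤ δ) {ε₁ ε₂ : ℝ} (hε₁ : ε₁ = 1 ∨ ε₁ = -1) (hε₂ : ε₂ = 1 ∨ ε₂ = -1)
    (hσ₁ : ∀ x ∈ Icc (0 - δ) (0 + δ), σ ≤ ε₁ * deriv (fun φ : ℝ => frameLevel μ K (levelPoint μ K 0 θ + levelPoint μ K 0 (ϑ + θ) - levelPoint μ K 0 (φ + θ))) x)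
    (hσ₂ : ∀ x ∈ Icc (ϑ - δ) (ϑ + δ), σ ≤ ε₂ * deriv (fun φ : ℝ => frameLevel μ K (levelPoint μ K 0 θ + levelPoint μ K 0 (ϑ + θ) - levelPoint μ K 0 (φ + θ))) x)
    (hfloor : ∀ t ∈ S, δ < |t - 0| → δ < |t - ϑ| → κ ≤ |frameLevel μ K (levelPoint μ K 0 θ + levelPoint μ K 0 (ϑ + θ) - levelPoint μ K 0 (t + θ))|)
    {φ : ℝ} (hφ : φ ∈ S) :
    |iteratedDeriv m (fun ψ : ℝ => frameLevel μ K (levelPoint μ K 0 ψ + levelPoint μ K 0 (ϑ + ψ) - levelPoint μ K 0 (φ + ψ))) θ| ≤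
      max ((m + 1).factorial * 𝒦 * D ^ (m + 1) / σ) (m.factorial * 𝒦 * D ^ m / κ) *
        |frameLevel μ K (levelPoint μ K 0 θ + levelPoint μ K 0 (ϑ + θ) - levelPoint μ K 0 (φ + θ))| := by
  have h0 : |(0 : ℝ)| < r := by simpa using hr
  have hK' : ∀ i, i ≤ m → ∀ p : Momentum, ‖iteratedFDeriv ℝ i (frameLevel μ K) p‖ ≤ 𝒦 := fun i hi p => hK i (by omega) p
  have hDrow' : ∀ i, 1 ≤ i → i ≤ m → (2 + 2 ^ i) * msD6 A₃ A₄ A₅ A₆ i ≤ D ^ i := fun i hi1 hi => hDrow i hi1 (by omega)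
  have hH₀0 : 0 ≤ (m.factorial : ℝ) * 𝒦 * D ^ m :=
    (abs_nonneg _).trans (abs_iteratedDeriv_partnerBand_pp_base_le_table hA hA20 hd hr hlo hhi hA₃ hA₄ hA₅ hA₆ (by omega) hK' hDrow' h0 h0 ϑ θ 0)
  refine abs_iteratedDeriv_partnerBand_pp_base_le_mul_abs_of_ceilings hA hd hr hlo hhi ϑ θ m hσ hκ hH₀0 hδ hε₁ hε₂ hσ₁ hσ₂ hfloor
    (fun _ _ x _ => ?_) (fun t _ _ _ => ?_) hφ
  · exact abs_deriv_iteratedDeriv_partnerBand_pp_base_le_table hA hA20 hd hr hlo hhi hA₃ hA₄ hA₅ hA₆ hm hK hDrow h0 h0 ϑ θ x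
  · exact abs_iteratedDeriv_partnerBand_pp_base_le_table hA hA20 hd hr hlo hhi hA₃ hA₄ hA₅ hA₆ (by omega) hK' hDrow' h0 h0 ϑ θ t

end Sizes

end Summit.HubbardSuperconductivity.HubbardSuperconductivity.Theorems.C4a

end
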